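import Summits.ResolutionOfSingularities.ResolutionOfSingularities.Theorems.PurelyInseparableDim4ResConeShadeTwoBranching
import Summits.ResolutionOfSingularities.ResolutionOfSingularities.Theorems.PurelyInseparableDim4ResConeShadeTwoNoCornerTrap
import HarnessLib
import HarnessLib.Audit.Tags

/-!
# Purely inseparable four-folds — K2(p), PHASE `d = 2`, PART VI: after the first translated step the chain lives in the
# `c = 3` classes with a PERSISTENT SQUARE on its free letter (every prime; idea-4 I-4-6 (FB)/(C3-MOVES))

[OURS · counted 0 · cell `res-dim4-pi` · seat res-dim4-p-7 g3 · K2(p) lane (holder res-dim4-p-12 lineage; desk WORDs #82 (c),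
#96 (a)); hand analysis res-dim4-idea-4 (card I-4-6).]  Nothing here proves K2(p), `NoIsolatedTrap p p`, or resolution of
singularities in dimension ≥ 4 / characteristic `p`.  AI kernel work, weaker than expert review.

Along a witnessed `Step0 p` chain of ISOLATED states off the floor, of constant shade `2`, with `x^{r₀} ∣ F₀`:
* §1 one step of the chain read through `…ShadeTwoBranching`: a TRANSLATED step (`b_k ≠ 0`) moves one letter `f`, lands at
  `W = p − 1` with `f` the UNIQUE free letter of the child and `x_f² ∈ supp g` there (`translated_step`).
* §2 **THE `c = 3` INVARIANT** `W_k = p − 1 ∧ ∃! free letter f_k ∧ q_{f_k f_k} ≠ 0` PROPAGATES (`cthree_succ`), and every step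
  from such a state is one of: a CORNER in the chart of a LIGHT letter (`r = 1`, ledger unchanged), an α-MOVE (light chart,
  the free letter translated, ledger unchanged), a SWAP (chart = the free letter, a light letter translated and freed);
  the chart letter always has `r ≤ 1` and becomes light, HEAVY letters (`r ≥ 2`) are never touched, the corner in the free
  chart (the β-move to `c = 4`) is blocked by the square.
* §3 **`exists_cthree_tail`**: by `no_shadeTwo_corner_chain` (`…ShadeTwoNoCornerTrap`) a translated step occurs, so every
  `d = 2` trap has a tail living in the `c = 3` classes with the invariant — and translated steps keep occurring.
Sequel: `…ResConeShadeTwoResidue` (heavy letters are constant, the one-light-letter class has no satellite step, so FT leaves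
exactly the two-light-letter α-tail on the ledger `{p − 3, 1, 1, 0}`, `p ≥ 5`).
bears_on: LADDER-RESOLUTION:D157-DOOR2 (res-dim4-pi · K2(p) · phase d = 2).  Supports stmt-ResolutionOfSingularities-16155
(helper).
-/

set_option linter.dupNamespace false -- mandated namespace of this single-conjunct summit

noncomputable section

namespace Summit.ResolutionOfSingularities.ResolutionOfSingularities.Theorems.PIDim4

namespace ResCone

open MvPolynomial Finset
open Literature.AlgebraicGeometry.Resolution
open Literature.AlgebraicGeometry.Resolution.CentreBlowup
open Literature.AlgebraicGeometry.Resolution.Hauser2010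
open Literature.AlgebraicGeometry.Resolution.HauserPerlega2019

variable {K : Type} [Field K] [DecidableEq K]

section Chain

variable {p : ℕ} [hp : Fact p.Prime] {c : ℕ → State K} {j : ℕ → Fin 4} {b : ℕ → Fin 4 → K}

/-! ## §1 One step of the chain -/

/-- **The data of step `k`**: `c (k+1) = step p univ (j k) (b k) (c k)`, `b k (j k) = 0`, the shade is kept, and the
letters of both ends. [folklore] -/
theorem chain_step (hw : FreeTail.IsWitnessedChain p c j b)
    (hc : ∀ k, IsIsolated p (c k).F ∧ Step0 p (c k) (c (k + 1)) ∧ ordZero (c k).F ≠ p ∧ (c k).shade = 2)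
    (hr0 : ∀ e ∈ (c 0).F.support, (c 0).r ≤ e) (k : ℕ) :
    c (k + 1) = CentreBlowup.step p Finset.univ (j k) (b k) (c k) ∧ b k (j k) = 0 ∧
      (CentreBlowup.step p Finset.univ (j k) (b k) (c k)).shade = (c k).shade ∧
      (∀ e ∈ (c k).F.support, (c k).r ≤ e) ∧
      ordZero (c k).F = (((c k).r.degree + 2 : ℕ) : ℕ∞) ∧ p ≤ (c k).r.degree + 1 ∧ (c k).r.degree + 4 ≤ 2 * p ∧
      IsIsolated p (CentreBlowup.step p Finset.univ (j k) (b k) (c k)).F ∧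
      (∀ e ∈ (CentreBlowup.step p Finset.univ (j k) (b k) (c k)).F.support,
        (CentreBlowup.step p Finset.univ (j k) (b k) (c k)).r ≤ e) ∧
      p ≤ (CentreBlowup.step p Finset.univ (j k) (b k) (c k)).r.degree + 1 ∧
      (CentreBlowup.step p Finset.univ (j k) (b k) (c k)).r.degree + 4 ≤ 2 * p := by
  have hc2 : ∀ k, IsIsolated p (c k).F ∧ Step0 p (c k) (c (k + 1)) := fun k => ⟨(hc k).1, (hc k).2.1⟩
  obtain ⟨-, hbj, -, -, hck⟩ := hw k
  obtain ⟨ho, hpW, hW2⟩ := shadeTwo_letters p hc hr0 k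
  obtain ⟨-, hpW1, hW21⟩ := shadeTwo_letters p hc hr0 (k + 1)
  rw [hck] at hpW1 hW21
  refine ⟨hck, hbj, ?_, IsolatedBand.isolated_chain_forall_le hc2 hr0 k, ho, hpW, hW2, ?_, ?_, hpW1, hW21⟩
  · rw [← hck, (hc (k + 1)).2.2.2, (hc k).2.2.2]
  · rw [← hck]; exact (hc (k + 1)).1
  · rw [← hck]; exact IsolatedBand.isolated_chain_forall_le hc2 hr0 (k + 1)

/-- **A TRANSLATED STEP** (`b k f ≠ 0`): `f ≠ j k` is the only moved letter, the child has `W = p − 1`, `f` is its UNIQUE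
free letter, the chart letter is light there, and `x_f² ∈ supp g_{k+1}`. [OURS · K2(p) phase d = 2] [folklore] -/
theorem translated_step (hw : FreeTail.IsWitnessedChain p c j b)
    (hc : ∀ k, IsIsolated p (c k).F ∧ Step0 p (c k) (c (k + 1)) ∧ ordZero (c k).F ≠ p ∧ (c k).shade = 2)
    (hr0 : ∀ e ∈ (c 0).F.support, (c 0).r ≤ e) (k : ℕ) {f : Fin 4} (hf : b k f ≠ 0) :
    f ≠ j k ∧ (c (k + 1)).r.degree + 1 = p ∧ (c (k + 1)).r f = 0 ∧ (∀ i, i ≠ f → 1 ≤ (c (k + 1)).r i) ∧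
      (c (k + 1)).r (j k) + p = (c k).r.degree + 2 ∧
      (∀ i, i ≠ j k → i ≠ f → b k i = 0 ∧ (c (k + 1)).r i = (c k).r i) ∧
      coeff (Finsupp.single f 2) (resForm (c (k + 1))) ≠ 0 := by
  have hp2 : 2 ≤ p := hp.out.two_le
  obtain ⟨hck, hbj, heq, hr, ho, hpW, hW2, hiso', hr', hpW', -⟩ := chain_step hw hc hr0 k
  have hfj : f ≠ j k := fun h => hf (h ▸ hbj)
  obtain ⟨hrf, hrj, hkept, hW'⟩ := ledger_of_moved hp2 hbj ho hr hW2 hiso' hr' hpW' hf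
  have hkept' := kept_of_moved hp2 hbj ho hr hW2 hiso' hr' hpW' hf
  have hsq := coeff_sq_resForm_step_ne_zero hbj rfl ho hr hpW hW2 heq hiso' hr' hpW' hfj hrf
  rw [← hck] at hrf hrj hkept hW' hsq
  refine ⟨hfj, hW', hrf, fun i hif => ?_, by rw [hrj]; omega, fun i hij hif => ⟨(hkept' i hij hif).1, (hkept i hij hif).1⟩,
    hsq⟩
  by_cases hij : i = j k
  · rw [hij, hrj]; omega
  · rw [(hkept i hij hif).1]; exact (hkept i hij hif).2

/-! ## §2 The `c = 3` invariant propagates -/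

/-- **THE `c = 3` INVARIANT PROPAGATES.**  If `W_k = p − 1`, `f` is the unique free letter of `c k` and `x_f² ∈ supp g_k`,
then the same holds at `k + 1` for some free letter `f′`, and: the chart letter has `r_k(j k) ≤ 1` and is light on the child
(`r_{k+1}(j k) = 1`); heavy letters are untouched (`r ≥ 2` on either side ⇒ equal multiplicities); if the chart is the
free letter (`j k = f`, a SWAP) then some light letter `u` (`r_k u = 1`) is moved and freed (`b k u ≠ 0`, `f′ = u`), otherwise
the chart is light, `f′ = f` and only `f` can move (CORNER or α-MOVE). [OURS · K2(p) phase d = 2] [folklore] -/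
theorem cthree_succ (hw : FreeTail.IsWitnessedChain p c j b)
    (hc : ∀ k, IsIsolated p (c k).F ∧ Step0 p (c k) (c (k + 1)) ∧ ordZero (c k).F ≠ p ∧ (c k).shade = 2)
    (hr0 : ∀ e ∈ (c 0).F.support, (c 0).r ≤ e) (k : ℕ) (hW : (c k).r.degree + 1 = p) {f : Fin 4}
    (hf0 : (c k).r f = 0) (hpos : ∀ i, i ≠ f → 1 ≤ (c k).r i)
    (hsq : coeff (Finsupp.single f 2) (resForm (c k)) ≠ 0) :
    (c (k + 1)).r.degree + 1 = p ∧ (c k).r (j k) ≤ 1 ∧ (c (k + 1)).r (j k) = 1 ∧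
      (∀ i, 2 ≤ (c k).r i → (c (k + 1)).r i = (c k).r i) ∧
      (∀ i, 2 ≤ (c (k + 1)).r i → (c (k + 1)).r i = (c k).r i) ∧
      ∃ f', (c (k + 1)).r f' = 0 ∧ (∀ i, i ≠ f' → 1 ≤ (c (k + 1)).r i) ∧
        coeff (Finsupp.single f' 2) (resForm (c (k + 1))) ≠ 0 ∧
        ((j k = f ∧ b k f' ≠ 0 ∧ (c k).r f' = 1 ∧ f' ≠ f) ∨
          (j k ≠ f ∧ (c k).r (j k) = 1 ∧ f' = f ∧ ∀ i, i ≠ f → b k i = 0)) := by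
  have hp2 : 2 ≤ p := hp.out.two_le
  obtain ⟨hck, hbj, heq, hr, ho, hpW, hW2, hiso', hr', hpW', hW2'⟩ := chain_step hw hc hr0 k
  obtain ⟨-, hpW1, -⟩ := shadeTwo_letters p hc hr0 (k + 1)
  -- the chart letter has `r ≤ 1`: `W′ = (W + 2 − p) + σ ≥ p − 1` and `σ ≤ W − r_j`
  have hdeg := degree_step_r' p (j k) (b k) (c k) ho
  rw [← hck] at hdeg
  have hσle : ∑ i ∈ Finset.univ.erase (j k), (if b k i = 0 then (c k).r i else 0) ≤
      ∑ i ∈ Finset.univ.erase (j k), (c k).r i := Finset.sum_le_sum fun i _ => by split_ifs <;> omega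
  have hsum := sum_erase_eq_degree_sub (c k).r (j k)
  have hrjW : (c k).r (j k) ≤ (c k).r.degree := Finsupp.le_degree (j k) (c k).r
  have hrj : (c k).r (j k) ≤ 1 := by omega
  -- the new boundary
  have hr1eq : (c (k + 1)).r = ((c k).r.filter (fun i => b k i = 0)).update (j k) ((c k).r.degree + 2 - p) := by
    rw [hck]; exact shadeTwo_step_r (j k) hbj (c k) ho hr
  have hrj1 : (c (k + 1)).r (j k) = 1 := by rw [hr1eq, Finsupp.update_apply, if_pos rfl]; omega
  rcases Nat.lt_or_ge ((c k).r (j k)) 1 with hlt | hge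
  · -- SWAP: the chart is the free letter `f`
    have hj0 : (c k).r (j k) = 0 := by omega
    have hjf : j k = f := by
      by_contra hne
      have := hpos (j k) hne
      omega
    -- the step is translated (a corner in the chart of `f` would break the shade)
    have hbne : b k ≠ 0 := by
      intro hb0
      rw [hb0, hjf] at heq
      exact shade_step_ne_of_coeff_sq_ne_zero (p := p) f rfl ho hr hpW hW2 hsq heq
    obtain ⟨u, hu⟩ : ∃ u, b k u ≠ 0 := by
      by_contra hall
      push Not at hall
      exact hbne (funext hall)
    obtain ⟨huj, hW', hru0, hpos', hrj', hkept, hsq'⟩ := translated_step hw hc hr0 k hu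
    have huf : u ≠ f := by rw [← hjf]; exact huj
    have hru : 1 ≤ (c k).r u := hpos u huf
    -- `r_u = 1`: `W′ = 1 + (W − r_u)`
    have hσ : ∑ i ∈ Finset.univ.erase (j k), (if b k i = 0 then (c k).r i else 0) =
        ∑ i ∈ (Finset.univ.erase (j k)).erase u, (c k).r i := by
      rw [← Finset.add_sum_erase _ _ (Finset.mem_erase.mpr ⟨huj, Finset.mem_univ u⟩), if_neg hu, zero_add]
      refine Finset.sum_congr rfl fun i hi => ?_
      have hiu : i ≠ u := Finset.ne_of_mem_erase hi
      have hij : i ≠ j k := Finset.ne_of_mem_erase (Finset.mem_of_mem_erase hi)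
      rw [if_pos (hkept i hij hiu).1]
    have hsum2 : (c k).r u + ∑ i ∈ (Finset.univ.erase (j k)).erase u, (c k).r i =
        ∑ i ∈ Finset.univ.erase (j k), (c k).r i :=
      Finset.add_sum_erase _ _ (Finset.mem_erase.mpr ⟨huj, Finset.mem_univ u⟩)
    have hru1 : (c k).r u = 1 := by omega
    refine ⟨hW', hrj, hrj1, fun i hi => ?_, fun i hi => ?_, u, hru0, hpos', hsq', Or.inl ⟨hjf, hu, hru1, huf⟩⟩
    · have hij : i ≠ j k := fun h => by rw [h, hj0] at hi; omega
      have hiu : i ≠ u := fun h => by rw [h, hru1] at hi; omega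
      exact (hkept i hij hiu).2
    · have hij : i ≠ j k := fun h => by rw [h, hrj1] at hi; omega
      have hiu : i ≠ u := fun h => by rw [h, hru0] at hi; omega
      exact (hkept i hij hiu).2
  · -- the chart is a LIGHT letter
    have hj1 : (c k).r (j k) = 1 := by omega
    have hjf : j k ≠ f := fun h => by rw [h, hf0] at hj1; omega
    by_cases hb0 : ∀ i, i ≠ f → b k i = 0
    · -- CORNER or α-MOVE: only `f` may move; the ledger is unchanged
      have hri : ∀ i, i ≠ j k → i ≠ f → (c (k + 1)).r i = (c k).r i := by
        intro i hij hif
        rw [hr1eq, Finsupp.update_apply, if_neg hij, Finsupp.filter_apply, if_pos (hb0 i hif)]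
      have hrf1 : (c (k + 1)).r f = 0 := by
        rw [hr1eq, Finsupp.update_apply, if_neg (Ne.symm hjf), Finsupp.filter_apply]
        split_ifs <;> first | exact hf0 | rfl
      have hsq1 : coeff (Finsupp.single f 2) (resForm (c (k + 1))) ≠ 0 := by
        rw [hck]
        exact coeff_sq_resForm_step_ne_zero hbj rfl ho hr hpW hW2 heq hiso' hr' hpW' (Ne.symm hjf) (by rw [← hck]; exact hrf1)
      have hpos1 : ∀ i, i ≠ f → 1 ≤ (c (k + 1)).r i := by
        intro i hif
        by_cases hij : i = j k
        · rw [hij, hrj1]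
        · rw [hri i hij hif]; exact hpos i hif
      have hW1 : (c (k + 1)).r.degree + 1 = p := by
        -- `W′ = 1 + (W − r_j) = W`
        have hσ : ∑ i ∈ Finset.univ.erase (j k), (if b k i = 0 then (c k).r i else 0) =
            ∑ i ∈ Finset.univ.erase (j k), (c k).r i := by
          refine Finset.sum_congr rfl fun i hi => ?_
          by_cases hif : i = f
          · rw [hif, hf0]; split_ifs <;> rfl
          · rw [if_pos (hb0 i hif)]
        rw [hσ] at hdeg
        omega
      refine ⟨hW1, hrj, hrj1, fun i hi => ?_, fun i hi => ?_, f, hrf1, hpos1, hsq1, Or.inr ⟨hjf, hj1, rfl, hb0⟩⟩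
      · have hij : i ≠ j k := fun h => by rw [h, hj1] at hi; omega
        have hif : i ≠ f := fun h => by rw [h, hf0] at hi; omega
        exact hri i hij hif
      · have hij : i ≠ j k := fun h => by rw [h, hrj1] at hi; omega
        have hif : i ≠ f := fun h => by rw [h, hrf1] at hi; omega
        exact hri i hij hif
    · -- a boundary letter other than `f` would move: impossible
      exfalso
      push Not at hb0
      obtain ⟨g, hgf, hg⟩ := hb0
      have hgj : g ≠ j k := fun h => hg (h ▸ hbj)
      have := (kept_of_moved hp2 hbj ho hr hW2 hiso' hr' hpW' hg f (Ne.symm hjf) (Ne.symm hgf)).2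
      omega

/-! ## §3 Every shade-2 trap has a `c = 3` tail -/

/-- **THE `c = 3` TAIL**: along an isolated above-floor shade-`2` chain with `x^{r₀} ∣ F₀` over a field of characteristic `p`,
from some index on every state has `W = p − 1`, a unique free letter `f` with `x_f² ∈ supp g`, every chart letter has
`r ≤ 1`, and heavy letters keep their multiplicities.  (A translated step exists by `no_shadeTwo_corner_chain`; then
`cthree_succ`.) [OURS · K2(p) phase d = 2] [folklore] -/
theorem exists_cthree_tail [CharP K p] (hw : FreeTail.IsWitnessedChain p c j b)
    (hc : ∀ k, IsIsolated p (c k).F ∧ Step0 p (c k) (c (k + 1)) ∧ ordZero (c k).F ≠ p ∧ (c k).shade = 2)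
    (hr0 : ∀ e ∈ (c 0).F.support, (c 0).r ≤ e) :
    ∃ k₁, ∀ k, k₁ ≤ k →
      (c k).r.degree + 1 = p ∧ (c k).r (j k) ≤ 1 ∧ (c (k + 1)).r (j k) = 1 ∧
        (∀ i, 2 ≤ (c k).r i → (c (k + 1)).r i = (c k).r i) ∧
        (∀ i, 2 ≤ (c (k + 1)).r i → (c (k + 1)).r i = (c k).r i) ∧
        ∃ f, (c k).r f = 0 ∧ (∀ i, i ≠ f → 1 ≤ (c k).r i) ∧ coeff (Finsupp.single f 2) (resForm (c k)) ≠ 0 := by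
  -- a translated step exists
  have htr : ∃ k f, b k f ≠ 0 := by
    by_contra hno
    push Not at hno
    exact no_shadeTwo_corner_chain p K hw (fun k => ⟨(hc k).1, (hc k).2.2.1, (hc k).2.2.2⟩) hr0 (k₀ := 0)
      (fun k _ => funext (hno k))
  obtain ⟨k₀, f₀, hf₀⟩ := htr
  obtain ⟨-, hW1, hrf, hpos, -, -, hsq⟩ := translated_step hw hc hr0 k₀ hf₀
  -- the invariant from `k₀ + 1` on
  have hinv : ∀ n, (c (k₀ + 1 + n)).r.degree + 1 = p ∧ ∃ f, (c (k₀ + 1 + n)).r f = 0 ∧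
      (∀ i, i ≠ f → 1 ≤ (c (k₀ + 1 + n)).r i) ∧ coeff (Finsupp.single f 2) (resForm (c (k₀ + 1 + n))) ≠ 0 := by
    intro n
    induction n with
    | zero => exact ⟨hW1, f₀, hrf, hpos, hsq⟩
    | succ n ih =>
      obtain ⟨hW, f, hf0, hposf, hsqf⟩ := ih
      obtain ⟨hW', -, -, -, -, f', hf'0, hpos', hsq', -⟩ := cthree_succ hw hc hr0 (k₀ + 1 + n) hW hf0 hposf hsqf
      exact ⟨hW', f', hf'0, hpos', hsq'⟩
  refine ⟨k₀ + 1, fun k hk => ?_⟩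
  obtain ⟨n, rfl⟩ : ∃ n, k = k₀ + 1 + n := ⟨k - (k₀ + 1), by omega⟩
  obtain ⟨hW, f, hf0, hposf, hsqf⟩ := hinv n
  obtain ⟨-, hrj, hrj1, hheavy, hheavy', -⟩ := cthree_succ hw hc hr0 (k₀ + 1 + n) hW hf0 hposf hsqf
  exact ⟨hW, hrj, hrj1, hheavy, hheavy', f, hf0, hposf, hsqf⟩

/-- **Translated steps keep occurring** (the corner theorem applied to every tail). [OURS · K2(p) phase d = 2] [folklore] -/
theorem exists_translated_beyond [CharP K p] (hw : FreeTail.IsWitnessedChain p c j b)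
    (hc : ∀ k, IsIsolated p (c k).F ∧ Step0 p (c k) (c (k + 1)) ∧ ordZero (c k).F ≠ p ∧ (c k).shade = 2)
    (hr0 : ∀ e ∈ (c 0).F.support, (c 0).r ≤ e) (k₀ : ℕ) : ∃ k f, k₀ ≤ k ∧ b k f ≠ 0 := by
  by_contra hno
  push Not at hno
  exact no_shadeTwo_corner_chain p K hw (fun k => ⟨(hc k).1, (hc k).2.2.1, (hc k).2.2.2⟩) hr0 (k₀ := k₀)
    (fun k hk => funext (hno k · hk))

end Chain

end ResCone

end Summit.ResolutionOfSingularities.ResolutionOfSingularities.Theorems.PIDim4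

end
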